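import Summits.BirchSwinnertonDyer.BirchSwinnertonDyer.Theorems.InertBadSignedBranchesCccOneLawOnTypeIstarZeroManinTwist
import Summits.BirchSwinnertonDyer.BirchSwinnertonDyer.Theorems.InertBadSignedBranchesInertBadAtThreeIstarZeroOddSupply
import Summits.BirchSwinnertonDyer.BirchSwinnertonDyer.Theorems.InertBadSignedBranchesInertBadAtThreeIstarZeroEveryCurve
import Summits.BirchSwinnertonDyer.BirchSwinnertonDyer.Theorems.InertBadSignedBranchesCccOneLawOnTypeIstarZeroOfEtaGZ
import Summits.BirchSwinnertonDyer.Rank1Residual.X12.CMIrreducible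
import Summits.BirchSwinnertonDyer.Rank1Residual.Additive.UnramifiedBaseChange
import HarnessLib

/-!
# Route `InertBadSignedBranches` (rung K8), D71 child `InertBadAtThreeIstarZero` (stmt-BirchSwinnertonDyer-19656):
# the CLASS-LEVEL Manin input at `3` on the type `(3, I₀*)` is a THEOREM — `3 ∤ c` for a modular
# parametrisation of EVERY CM curve of signed type `(3, I₀*)`, from Mazur 1978 Cor. 4.1 at the GOOD prime
# `3` of the `(−3)`-twin; hence `InertBadAtThreeIstarZero ⟺ X12.O10.LowerHalfOnType 3 I₀*` modulo
# PUBLISHED facts only (helper `--supports` 19656; cell bsd-cm, seat bsd-cm-k8i-c2 g6, corollary of the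
# seat's `…CccOneLawOnTypeIstarZeroManinTwist` for the sibling hand bsd-cm-k8i-c41; nothing booked)

THE GAP. k8i-c41's Kolyvagin-side normal form of 19656 (p416932, p431719:
`InertBadAtThreeEveryCurve.inertBadAtThreeIstarZero_iff_lowerHalfOnType_three_of_maninOptimal`) reads
«child ⟺ `LowerHalfOnType 3 I₀*`» modulo eight published facts, Cassels, AND Manin's conjecture at `3`
for the optimal curves of the corner (`hManinOpt`) — «CLASS-LEVEL `3 ∤ c` at an additive `3` with `9 ∣ N`
is in NO source» (CENSUS-PI-AT-3 §Manin input; Cremona's `c = 1` to `300000` covers 42 of the 57 PS@3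
classes). THIS FILE removes `hManinOpt` (and `hCassels`) on the type `(3, I₀*)`:

* `exists_modularParametrizationData_not_dvd_of_hasSignedLocalType_IstarZero_of_ne_two` — at EVERY ODD
  `p`, every globally minimal `W` of signed type `(p, I₀*)` (CM, `p` inert, Kodaira `I₀*`) has a datum at
  level `N_W` with `p ∤ c`: the seat's CM-free theorem
  `CccOneManinTwist.exists_modularParametrizationData_not_dvd_of_twist_good` (Stevens 1989 §5 run
  `p`-locally in `X₀`-currency + Mazur 1978 Cor. 4.1 at the good prime of the twin; needs only `p ≠ 2`)
  fed with k8i-c41's odd-prime twin supply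
  `InertBadOdd.exists_goodTwist_pStar_of_hasSignedLocalType_IstarZero_of_ne_two`, additivity
  (`EtaGZ.addv_of_hasSignedLocalType_of_twist_good`) and irreducibility at the inert odd `p`
  (`X12.irr_of_cmInert`);
* **`missingUpperBoundAt_three_of_hasSignedLocalType_IstarZero`** — the upper half of `BSD(W, 3)` for
  EVERY rank-one `W` of type `(3, I₀*)`, ALL conductors, from the published facts
  `hGZ hKo hMN hGZK hmod hnf hFH hCM8 hMaz` (x1b's `X12.missingUpperBoundAt_three_of_classX12_of_bad'` fed
  with the datum of `W` itself — no optimal member, no Cassels);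
* **`inertBadAtThreeIstarZero_of_lowerHalfOnType_three_of_facts`**,
  **`inertBadAtThreeIstarZero_iff_lowerHalfOnType_three_of_facts`** — 19656 ⟺ `LowerHalfOnType 3 I₀*`
  modulo published facts ONLY (Mazur Cor. 4.1 replacing Manin's conjecture at `3`).
READING (no label change; the planner's census words stand): on PS@3 the per-class «Manin input at 3»
column of CENSUS-PI-AT-3 is met CLASS-WIDE by a theorem (was: 42/57 by Cremona ≤ 300000, 14 by
`opt_man` DATA, 1 by CNS + degree DATA); the child's ONLY open content is STEP L at `3` on the type. The
SC@3 classes (types III/III*, item 19657) are NOT touched (no quadratic good twin).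

HONEST LABEL: theorems only (no `def`, no named fact, no `sorry`); CONDITIONAL on displayed published named
facts (Mazur 1978 Cor. 4.1 = `mazur_not_dvd_maninConstant_of_odd`, printed proof, hypothesis `hMaz`);
19656, STEP L at `3` and O10 stay OPEN; BSD is not proved for any curve here; nothing booked.

References: B. Mazur, Invent. Math. 44 (1978) Cor. 4.1; G. Stevens, Invent. Math. 98 (1989) §5;
A. Matar, J. Nekovář, JTNB 31 (2019) Thm. 0.3; A. Agashe, K. Ribet, W. Stein, PAMQ 2 (2006) §2;
R. L. Miller, LMS J. Comput. Math. 14 (2011) §1.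
-/

set_option autoImplicit false
set_option linter.dupNamespace false

noncomputable section

open scoped Classical MatrixGroups ModularForm NumberField

open CongruenceSubgroup Field WeierstrassCurve NumberField IsDedekindDomain
open Literature.NumberTheory.EllipticCurves
open Literature.NumberTheory.EllipticCurves.ModularForms
open Literature.NumberTheory.EllipticCurves.Rank1Residual
open Literature.NumberTheory.EllipticCurves.Rank1Residual.Typed
open Summit.BirchSwinnertonDyer.Rank1Residual
open Summit.BirchSwinnertonDyer.Rank1Residual.X12.O10
open Summit.BirchSwinnertonDyer.BirchSwinnertonDyer.Theses.InertBadSignedBranches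

namespace Summit.BirchSwinnertonDyer.BirchSwinnertonDyer.Theorems.CccOneManinTwist

/-! ## §1 The Manin datum on the type `(p, I₀*)` at every ODD `p` -/

/-- **The Manin datum on the signed type `(p, I₀*)` at every ODD prime `p`** (in particular `p = 3`):
every globally minimal `W` of signed local type `(p, I₀*)` admits a modular parametrisation datum at
level `N_W` with `p ∤ c` — `exists_modularParametrizationData_not_dvd_of_twist_good` (needs `p ≠ 2` only)
with the odd-prime twin of `InertBadOdd.exists_goodTwist_pStar_of_hasSignedLocalType_IstarZero_of_ne_two`.
CONDITIONAL on `hnf`, `hMaz`; nothing booked. [cite: Mazur1978, Cor. 4.1]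
[cite: SilvermanATAEC1994, IV.9.4 Step 6 (PDF p. 345)] -/
theorem exists_modularParametrizationData_not_dvd_of_hasSignedLocalType_IstarZero_of_ne_two
    (hnf : exists_isNewformOf) (hMaz : mazur_not_dvd_maninConstant_of_odd) (p : ℕ) [hp : Fact p.Prime]
    (hp2 : p ≠ 2) (W : WeierstrassCurve ℚ) [W.IsElliptic] [W.IsGloballyMinimal] {N : ℕ} [NeZero N]
    (hN : W.conductorNorm ℤ = N) (hT : HasSignedLocalType W p (.Istar 0)) :
    ∃ Dt : ModularParametrizationData W N, ¬ (p : ℤ) ∣ Dt.c := by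
  obtain ⟨V, hVe, hVm, C, hCV, hgood, -, -, hinV, -⟩ :=
    InertBadOdd.exists_goodTwist_pStar_of_hasSignedLocalType_IstarZero_of_ne_two W hT hp2
  haveI := hVe
  haveI := hVm
  have hadd := Additive.hasAdditiveReductionAt_of_addv W p
    (EtaGZ.addv_of_hasSignedLocalType_of_twist_good W hT hp2 C hCV hgood)
  exact exists_modularParametrizationData_not_dvd_of_twist_good hnf hMaz W hN p hp2
    (Additive.primesEquiv_symm_apply_coe p) hadd V C hCV hgood
    (X12.irr_of_cmInert W p hp2 hT.2.1) (X12.irr_of_cmInert V p hp2 hinV)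

/-! ## §2 `p = 3`: the upper half on the type `(3, I₀*)` for every curve, and 19656 ⟺ STEP L at `3` -/

section Three

variable
  (hGZ : ∀ (N : ℕ) [NeZero N] (W : WeierstrassCurve ℚ) (K : Type) [Field K] [NumberField K],
    gross_zagier N W K)
  (hKo : ∀ (N : ℕ) [NeZero N] (W : WeierstrassCurve ℚ) (K : Type) [Field K] [NumberField K],
    kolyvagin N W K)
  (hMN : ∀ (N : ℕ) [NeZero N] (W : WeierstrassCurve ℚ) (K : Type) [Field K] [NumberField K],
    MatarNekovar2019.thm03_padicValNat_card_sha_le_of_irreducible N W K)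
  (hGZK : rank_eq_analyticRank_of_analyticRank_le_one) (hmod : hasEntireLFunction_rat)
  (hnf : exists_isNewformOf) (hFH : friedbergHoffstein_exists_heegnerField_split_twist_ne_zero)
  (hCM8 : bsdTriple_of_hasCM_of_L_one_ne_zero) (hMaz : mazur_not_dvd_maninConstant_of_odd)

include hGZ hKo hMN hGZK hmod hnf hFH hCM8 hMaz

/-- **The upper half of `BSD(W, 3)` for EVERY rank-one curve of signed type `(3, I₀*)`, all conductors,
from PUBLISHED facts alone**: `MissingUpperBoundAt W 3` (`ord₃ #Ш(W) ≤ ord₃ #Ш(W)_an`) — x1b's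
`X12.missingUpperBoundAt_three_of_classX12_of_bad'` (Kolyvagin–Matar–Nekovář over a Friedberg–Hoffstein
field, CM rank-zero triple for the twist, `3 ∤ ∏ c_ℓ` for `K ≠ ℚ(√−3)`) fed with the datum of §1 for `W`
ITSELF. Compare `InertBadAtThreeEveryCurve.missingUpperBoundAt_three_of_cmInert_of_bad_of_maninOptimal`
(Manin's conjecture at `3` + Cassels) and `…_of_conductorNorm_le` (`N ≤ 300000`). CONDITIONAL; nothing
booked. [cite: Mazur1978, Cor. 4.1] [cite: MatarNekovar2019, Thm. 0.3 and §0.11] -/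
theorem missingUpperBoundAt_three_of_hasSignedLocalType_IstarZero
    (W : WeierstrassCurve ℚ) [W.IsElliptic] [W.IsGloballyMinimal] [Fact (Nat.Prime 3)]
    (hT : HasSignedLocalType W 3 (.Istar 0)) (hr : W.analyticRank = 1) : MissingUpperBoundAt W 3 := by
  haveI : NeZero (W.conductorNorm ℤ) := ⟨(W.conductorNorm_pos_holds).ne'⟩
  obtain ⟨D, hD⟩ := exists_modularParametrizationData_not_dvd_of_hasSignedLocalType_IstarZero_of_ne_two
    hnf hMaz 3 (by norm_num) W rfl hT
  exact X12.missingUpperBoundAt_three_of_classX12_of_bad' hGZ hKo hMN hGZK hmod hnf hFH hCM8 W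
    (classX12_of_hasSignedLocalType W 3 hT hr) hT.2.2.1 hT.2.1.1 D (by exact_mod_cast hD)

/-- **`InertBadAtThreeIstarZero` (19656) ⟸ `X12.O10.LowerHalfOnType 3 I₀*` + PUBLISHED facts ONLY**:
k8i-c41's `inertBadAtThreeIstarZero_of_lowerHalfOnType_three_of_maninOptimal` with Manin's conjecture at
`3` (`hManinOpt`) replaced by Mazur 1978 Cor. 4.1 and Cassels dropped. So the child's ONLY open content is
STEP L at `3` on the type. CONDITIONAL; nothing booked; 19656 stays OPEN.
[cite: Mazur1978, Cor. 4.1] [cite: MatarNekovar2019, Thm. 0.3 and §0.11] [cite: Miller2011LMS, §1 and Def. 1.1] -/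
theorem inertBadAtThreeIstarZero_of_lowerHalfOnType_three_of_facts (hlow : LowerHalfOnType 3 (.Istar 0)) :
    InertBadAtThreeIstarZero := by
  unfold InertBadAtThreeIstarZero
  intro W _ _ _ hT hr _
  exact missingPPartAt_of_lower_of_upper W 3 (hlow W hT hr)
    (missingUpperBoundAt_three_of_hasSignedLocalType_IstarZero hGZ hKo hMN hGZK hmod hnf hFH hCM8 hMaz W
      hT hr)

/-- **`InertBadAtThreeIstarZero ⟺ X12.O10.LowerHalfOnType 3 I₀*` modulo PUBLISHED facts ONLY** (the
nine displayed; (→) is k8i-c41's GZK-only `lowerHalfOnType_three_IstarZero_of_inertBadAtThreeIstarZero`).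
CONDITIONAL; nothing booked; both sides stay OPEN. [cite: Mazur1978, Cor. 4.1]
[cite: MatarNekovar2019, Thm. 0.3 and §0.11] [cite: Miller2011LMS, §1 and Def. 1.1] -/
theorem inertBadAtThreeIstarZero_iff_lowerHalfOnType_three_of_facts :
    InertBadAtThreeIstarZero ↔ LowerHalfOnType 3 (.Istar 0) :=
  ⟨InertBadAtThreeEveryCurve.lowerHalfOnType_three_IstarZero_of_inertBadAtThreeIstarZero hGZK,
    inertBadAtThreeIstarZero_of_lowerHalfOnType_three_of_facts hGZ hKo hMN hGZK hmod hnf hFH hCM8 hMaz⟩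

end Three

end Summit.BirchSwinnertonDyer.BirchSwinnertonDyer.Theorems.CccOneManinTwist

end
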